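import Mathlib

/-!
# Monotonicity of a continuous primitive off a finite set

Helper of the algebraic-area layer of crux stmt-KontsevichZagierPeriods-9847 (`PlanarK0Injective`,
route SymplecticScissors, line lead seat c5).

Two facts of real analysis used to flatten vertical bands by the primitive `F` of a fibre-length
function:

* `monotone_of_hasDerivAt_nonneg_off_finite`: a continuous `F : ℝ → ℝ` with `HasDerivAt F (g x) x`
  and `0 ≤ g x` off a finite set `B` is monotone (mean value theorem on each closed interval whose
  interior misses `B`, glued at the finitely many points of `B` by induction on `B`);
* `strictMonoOn_of_monotone_of_hasDerivAt_pos`: a monotone `F` with `HasDerivAt F (g x) x` and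
  `0 < g x` at every point `x` of an open set `U` is strictly monotone on `U` (for `x < y` in `U`,
  `F` is strictly increasing on a small interval `[x, z] ⊆ U` with `z < y`, and `F z ≤ F y`).
-/

open Set Filter
open scoped Topology

namespace Summit.KontsevichZagierPeriods.SymplecticScissors.PlanarK0InjectiveAlgebraicLayer

/-- Mean value step: if `F` is continuous and has a nonnegative derivative `g z` at every point
`z` of the open interval `(x, y)`, `x ≤ y`, then `F x ≤ F y`. [folklore] -/
theorem apply_le_apply_of_hasDerivAt_nonneg_Ioo {F g : ℝ → ℝ} (hF : Continuous F) {x y : ℝ}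
    (hxy : x ≤ y) (hd : ∀ z ∈ Ioo x y, HasDerivAt F (g z) z) (hg : ∀ z ∈ Ioo x y, 0 ≤ g z) :
    F x ≤ F y := by
  have hmono : MonotoneOn F (Icc x y) := by
    refine monotoneOn_of_hasDerivWithinAt_nonneg (f' := g) (convex_Icc x y) hF.continuousOn
      (fun z hz ↦ ?_) (fun z hz ↦ ?_)
    · rw [interior_Icc] at hz ⊢
      exact (hd z hz).hasDerivWithinAt
    · rw [interior_Icc] at hz
      exact hg z hz
  exact hmono (left_mem_Icc.2 hxy) (right_mem_Icc.2 hxy) hxy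

/-- If `F : ℝ → ℝ` is continuous and, off a finite set `B`, has a derivative `g x ≥ 0`, then `F`
is monotone. (Induction on `B`: on an interval whose interior misses `B` this is the mean value
theorem; a point `a ∈ B` strictly inside `[x, y]` splits it into `[x, a]` and `[a, y]`, and only
the open halves matter, so no differentiability at `a` is needed.) [folklore] -/
theorem monotone_of_hasDerivAt_nonneg_off_finite {F g : ℝ → ℝ} (hF : Continuous F) {B : Set ℝ}
    (hB : B.Finite) (hd : ∀ x ∉ B, HasDerivAt F (g x) x) (hg : ∀ x ∉ B, 0 ≤ g x) : Monotone F := by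
  -- generalise over the exceptional set, keeping only the hypotheses on open intervals
  suffices H : ∀ x y : ℝ, x ≤ y → (∀ z ∈ Ioo x y, z ∉ B → HasDerivAt F (g z) z) →
      (∀ z ∈ Ioo x y, z ∉ B → 0 ≤ g z) → F x ≤ F y from
    fun x y hxy ↦ H x y hxy (fun z _ hz ↦ hd z hz) (fun z _ hz ↦ hg z hz)
  clear hd hg
  induction B, hB using Set.Finite.induction_on with
  | empty =>
    intro x y hxy hd hg
    exact apply_le_apply_of_hasDerivAt_nonneg_Ioo hF hxy (fun z hz ↦ hd z hz (notMem_empty z))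
      (fun z hz ↦ hg z hz (notMem_empty z))
  | @insert a S _ _ ih =>
    intro x y hxy hd hg
    -- a point off `S` other than `a` is off `insert a S`
    have key : ∀ z, z ≠ a → z ∉ S → z ∉ insert a S := fun z hza hzS h ↦
      (Set.mem_insert_iff.1 h).elim hza hzS
    by_cases ha : a ∈ Ioo x y
    · -- split `[x, y]` at `a`
      have h₁ : F x ≤ F a := ih x a ha.1.le
        (fun z hz hzS ↦ hd z ⟨hz.1, hz.2.trans ha.2⟩ (key z hz.2.ne hzS))
        (fun z hz hzS ↦ hg z ⟨hz.1, hz.2.trans ha.2⟩ (key z hz.2.ne hzS))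
      have h₂ : F a ≤ F y := ih a y ha.2.le
        (fun z hz hzS ↦ hd z ⟨ha.1.trans hz.1, hz.2⟩ (key z hz.1.ne' hzS))
        (fun z hz hzS ↦ hg z ⟨ha.1.trans hz.1, hz.2⟩ (key z hz.1.ne' hzS))
      exact h₁.trans h₂
    · exact ih x y hxy
        (fun z hz hzS ↦ hd z hz (key z (fun h ↦ ha (h ▸ hz)) hzS))
        (fun z hz hzS ↦ hg z hz (key z (fun h ↦ ha (h ▸ hz)) hzS))

/-- If `F : ℝ → ℝ` is monotone and at every point `x` of an open set `U` has a derivative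
`g x > 0`, then `F` is strictly monotone on `U`: for `x < y` with `x ∈ U` there is a closed
interval `[x, z] ⊆ U` with `x < z < y`, on which `F` has positive derivative and hence is strictly
increasing (mean value theorem), so `F x < F z ≤ F y`. [folklore] -/
theorem strictMonoOn_of_monotone_of_hasDerivAt_pos {F g : ℝ → ℝ} (hF : Monotone F) {U : Set ℝ}
    (hU : IsOpen U) (hd : ∀ x ∈ U, HasDerivAt F (g x) x) (hg : ∀ x ∈ U, 0 < g x) :
    StrictMonoOn F U := by
  intro x hx y _ hxy
  -- a closed interval `[x, z] ⊆ U` with `x < z < y`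
  obtain ⟨u, hu, huU⟩ := exists_Ico_subset_of_mem_nhds' (hU.mem_nhds hx) hxy
  obtain ⟨z, hxz, hzu⟩ := exists_between hu.1
  have hsub : Icc x z ⊆ U := fun w hw ↦ huU ⟨hw.1, hw.2.trans_lt hzu⟩
  -- `F` is strictly increasing on `[x, z]` (positive derivative on `U`), and `F z ≤ F y`
  have hmono : StrictMonoOn F (Icc x z) :=
    strictMonoOn_of_hasDerivWithinAt_pos (convex_Icc x z)
      (fun w hw ↦ (hd w (hsub hw)).continuousAt.continuousWithinAt)
      (fun w hw ↦ (hd w (hsub (interior_subset hw))).hasDerivWithinAt)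
      (fun w hw ↦ hg w (hsub (interior_subset hw)))
  exact (hmono (left_mem_Icc.2 hxz.le) (right_mem_Icc.2 hxz.le) hxz).trans_le
    (hF (hzu.le.trans hu.2))

/-! ## Registered anchor -/

/-- Registered anchor of this helper file (crux protocol `--supports`): the two facts
`monotone_of_hasDerivAt_nonneg_off_finite` and `strictMonoOn_of_monotone_of_hasDerivAt_pos`
in binder-free form. [folklore] -/
theorem helper_algebraicLayer_mono :
    (∀ (F g : ℝ → ℝ) (B : Set ℝ), Continuous F → Set.Finite B →
      (∀ x ∉ B, HasDerivAt F (g x) x) → (∀ x ∉ B, 0 ≤ g x) → Monotone F) ∧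
    (∀ (F g : ℝ → ℝ) (U : Set ℝ), Monotone F → IsOpen U →
      (∀ x ∈ U, HasDerivAt F (g x) x) → (∀ x ∈ U, 0 < g x) → StrictMonoOn F U) :=
  ⟨fun _ _ _ hF hB hd hg ↦ monotone_of_hasDerivAt_nonneg_off_finite hF hB hd hg,
    fun _ _ _ hF hU hd hg ↦ strictMonoOn_of_monotone_of_hasDerivAt_pos hF hU hd hg⟩

end Summit.KontsevichZagierPeriods.SymplecticScissors.PlanarK0InjectiveAlgebraicLayer
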